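import Summits.HodgeConjecture.HodgeConjecture.Theorems.R90S6HeckeThreeTermRecursion      -- ★ W8-g generic (p09): `doubleCosetOperator_mul_pow_eq_of_contracting`, `doubleCosetOperator_mul_self_eq_of_contracting`
import Summits.HodgeConjecture.HodgeConjecture.Theorems.K2LiuRankOneHeckeNeighboursTwo     -- ★ (hLiu418 organ (26-n) H2): `exists_contractingTransversal_unitary_two` — the N = 2 contracting transversal, `(|X₊|, |X₀|) = (Q, √Q − 1)`
import Literature.NumberTheory.Automorphic.UnitaryRankOneBasicHeckeOperator                 -- ★ m = 1 at N = 2: `satakeTransform_doubleCosetOperator_basic_two`, `heckeEigencharacter_doubleCosetOperator_basic_two`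
import HarnessLib

/-!
# R90 · S6 — WAVE 8 card W8-g′: MACDONALD'S RANK-ONE RECURRENCE FOR THE UNRAMIFIED `U(2) ≅ U(1,1)` — in the spherical Hecke algebra
# `ℋ_k(U(σ, antidiag(1,1))(K), K₀)`: `φ₁ · φ_m = φ_{m+1} + (√Q − 1) φ_m + Q φ_{m−1}` (`φ_m = 1_{K₀ tᵐ K₀}`, `t = diag(ϖ, ϖ⁻¹)`, `Q = #𝓀 = q_v²`)
# (`Theorems/R90S6MacdonaldRankOneU2.lean`)

Cell `hodgecm-mathlib`, crux H413 (`stmt-HodgeConjecture-24833`), route of record `HCCMUnconditional`; programme R90-TF, section S6 (base `R90-C14`), seat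
R90-C14-p03 (g2); S6 card W8-g′ «N = 2 BRICKS FOR THE GENERIC RECURSION» (dealer R90-C14-plan (g2), R90 bus 2026-09-05T00:05:56Z), DAG r5 row E1.3.2.1 at the
`U(1,1)_w`-factor of `H_w = U(2) × U(1)`.  Helper lane `--supports stmt-HodgeConjecture-24833 --as helper`; THEOREMS ONLY (no definition, no instance, no notation, no
named fact, no `sorry`); imports = ★ p09 W8-g generic `Theorems.R90S6HeckeThreeTermRecursion` + ★ `Theorems.K2LiuRankOneHeckeNeighboursTwo` (the N = 2 bricks, ALREADY ★
in the hLiu418 estate — cited by name, not retyped) + HarnessLib; Theorems import Theorems, never `Lines/`.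

THE PRINT.  [Macdonald1971, Ch. V §3]: on a semi-homogeneous tree with degrees `a + 1` (class of the base vertex) and `b + 1` the Hecke operators `φ_m = 1_{K tᵐ K}`
satisfy `φ₁ φ_m = φ_{m+1} + (b − 1) φ_m + ab·φ_{m−1}` (`m ≥ 2`), `φ₁² = φ₂ + (b − 1) φ₁ + (a + 1) b`; for the unramified quasi-split `U(2)(E_w ∕ F_v) ≅ U(1,1)` and its
hyperspecial `K₀` the tree is the `(q_v + 1)`-REGULAR tree (`a = b = q_v`; [Tits1979] §2.10, §3.3.3; [BruhatTits1972] (4.4.3)–(4.4.4); [SerreTrees1980] II.1.1), i.e. with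
`Q := #𝓀[E_w] = q_v²`, `√Q = q_v`: `ab = Q`, `b − 1 = √Q − 1`, `(a + 1) b = Q + √Q`.

WHAT IS PROVED (`hd : UnramifiedLocalConjDatum σ ϖ`, `σ ≠ id`, finite residue field `𝓀` of cardinality `Q`; `t ∈ U(σ, J₀)` ANY element with matrix
`diag(ϖ, ϖ⁻¹)` — a BINDER as in ★ `K2LiuRankOneHeckeNeighboursTwo` (inhabited: ★ `zpowDiagGL_mem_unitaryGroupOfForm` at `a = (1, −1)`), `φ_m = doubleCosetOperator K₀ (tᵐ)`,
`K₀ = unitaryInt`; `(U, K₀)` a Hecke pair as an instance binder, dischargeable by ★ `isHeckeTriple_unitaryInt_of_finite_residueField hd.vϖ`):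
* **`doubleCosetOperator_mul_pow_two`** (`m ≥ 2`, any comm. ring `k`): `φ₁ · φ_m = φ_{m+1} + (√Q − 1) · φ_m + Q · φ_{m−1}`;
* **`doubleCosetOperator_mul_self_two`**: `φ₁ · φ₁ = φ₂ + (√Q − 1) · φ₁ + (Q + √Q) · 1`
* §2 (`k = ℂ`) **`satakeTransform_doubleCosetOperator_mul_pow_two_succ`**: `𝒮(φ_{m+1}) = √Q·(x^{(1,−1)} + x^{(−1,1)})·𝒮(φ_m) − Q·𝒮(φ_{m−1})` (`m ≥ 2`;
  with ★ `satakeTransform_doubleCosetOperator_basic_two` `𝒮(φ₁) = √Q·(x^{ℓ₁}+x^{ℓ₋₁}) + (√Q−1)` this GENERATES every `𝒮(φ_m)` on the `(q_v+1)`-regular tree);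
  **`heckeEigencharacter_doubleCosetOperator_mul_pow_two_succ`**: `λ_β(φ_{m+1}) = √Q(z + z⁻¹)·λ_β(φ_m) − Q·λ_β(φ_{m−1})`, `z = β₀β₁⁻¹` — the N = 2 twins of
  p09's F2 §3, same two-line proofs (algebra hom + `linear_combination`).
§1 is ONE application each of ★ p09 `doubleCosetOperator_mul_pow_eq_of_contracting` ∕ `…_mul_self_eq_of_contracting` to the packaged N = 2 datum ★
`exists_contractingTransversal_unitary_two hd hσ t ht` (`K_P ≤ K₀` contracted by `t`, `t⁻¹ ∈ K₀tK₀`, shells disjoint, `X₊ ∪ X₀ ∪ {t⁻¹}` a transversal of `K₀tK₀∕K₀`,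
`|X₊| = Q` ★ `exists_transversal_borelInt_two`, `|X₀| = √Q − 1` ★ `exists_transversal_unip_two`, ★ `bijOn_heckeNeighbours_two`).  The degree at `m = 1` is `Q + √Q = q_v² + q_v`
(= p10's W8-e″ `ncard_orbit_torusGen_pow_two` at `m = 1` once ★; ★ `card_orbit_basic_two`); the N = 3 sibling is p09's `Theorems/R90S6MacdonaldRankOne.lean`.
HONEST LABEL: local spherical Hecke-algebra structure constants; proves no printed global statement, discharges no citation; count-neutral helper until E1.3.2.1 ∕ E1.3.6
(H-side) consume it.  HC_CM is proved only modulo the 7 printed citations (2 remaining named inputs: hLiu418 = stmt-HodgeConjecture-24832, h413 = stmt-HodgeConjecture-24833) until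
rung 0 closes; REL ≠ ★ ≠ BUILT.

## Tree search
★ `Summit.HodgeConjecture.HodgeConjecture.Cruxes.HLiu418.K2LiuRankOneHeckeNeighboursTwo.exists_contractingTransversal_unitary_two` (+ `bijOn_heckeNeighbours_two`,
`exists_transversal_borelInt_two`, `exists_transversal_unip_two`) [Theorems/K2LiuRankOneHeckeNeighboursTwo.lean :216 :47 :123 :176]; ★ operator-on-`V^K` twin
`K2LiuHeckeShellRecursion.heckeOperator_pow_apply_eq_smul_of_contracting`; ★ `isHeckeTriple_unitaryInt_of_finite_residueField` [HeckePairsValuedFiniteResidueField :217].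
Dedup: `rg "mul_pow_two|MacdonaldRankOneU2|torusGen_mul_pow_two"` over `lean/` — no hit.

## References
* [Macdonald1971] I. G. Macdonald, *Spherical functions on a group of p-adic type*, Ramanujan Inst. Publ. 2 (1971), Ch. V §3.
* [CartierCorvallis1979] P. Cartier, *Representations of 𝔭-adic groups: a survey*, PSPM 33.1 (1979), §IV (4.2), Thm. 4.1.
* [BruhatTits1972] F. Bruhat, J. Tits, *Groupes réductifs sur un corps local I*, Publ. Math. IHÉS 41 (1972), (4.4.3)–(4.4.4).
* [Tits1979] J. Tits, *Reductive groups over local fields*, PSPM 33.1 (1979), §2.10, §3.3.3.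
* [SerreTrees1980] J.-P. Serre, *Trees* (1980), II.1.1.
-/

set_option autoImplicit false
-- the mandated namespace repeats the single-problem summit's segment (`HodgeConjecture.HodgeConjecture`)
set_option linter.dupNamespace false

noncomputable section

open scoped Valued WithZero Matrix MatrixGroups Pointwise
open MulAction ConjAct

namespace Summit.HodgeConjecture.HodgeConjecture.R90.S6

open Literature.NumberTheory.Automorphic Literature.NumberTheory.Automorphic.HermitianLattice
  Literature.NumberTheory.Automorphic.HermitianLattice.UnramifiedLocalConjDatum Literature.NumberTheory.Automorphic.CartanUnique
  Literature.NumberTheory.Automorphic.SymplecticCartan Literature.NumberTheory.Automorphic.heckeAlgebra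
  Summit.HodgeConjecture.HodgeConjecture.Cruxes.HLiu418.K2LiuRankOneHeckeNeighboursTwo

variable {K : Type*} [Field K] [Valued K ℤᵐ⁰] {σ : K →+* K} {ϖ : K} [Finite 𝓀[K]]
  [IsHeckeTriple (⊤ : Submonoid (unitaryGroupOfForm σ ((StdForm.antidiagonal 2).over K))) (unitaryInt σ ((StdForm.antidiagonal 2).over K))
    (unitaryInt σ ((StdForm.antidiagonal 2).over K))]
  {k : Type*} [CommRing k]

/-- **MACDONALD'S RECURRENCE IN THE HECKE ALGEBRA OF THE UNRAMIFIED `U(2) ≅ U(1,1)`, `m ≥ 2`.**  For `hd : UnramifiedLocalConjDatum σ ϖ` with `σ ≠ id`,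
finite residue field `𝓀` of cardinality `Q` (`= q_w = q_v²`), any `t ∈ U(σ, antidiag(1,1))(K)` with matrix `diag(ϖ, ϖ⁻¹)`, and `φ_m = 1_{K₀ tᵐ K₀} ∈ ℋ_k(U, K₀)`:
`φ₁ · φ_m = φ_{m+1} + (√Q − 1) · φ_m + Q · φ_{m−1}` — the generic ★ `doubleCosetOperator_mul_pow_eq_of_contracting` at the N = 2 contracting transversal ★
`exists_contractingTransversal_unitary_two` (`(|X₊|, |X₀|) = (Q, √Q − 1) = (q_v², q_v − 1)`): the radius-one pattern `(ab, b − 1, 1) = (q_v², q_v − 1, 1)` of the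
`(q_v + 1)`-regular Bruhat–Tits tree of `U(1,1)_w`. [cite: Macdonald1971, Ch. V §3] [cite: CartierCorvallis1979, §IV (4.2), Thm. 4.1] [cite: BruhatTits1972, (4.4.3)–(4.4.4)]
[cite: SerreTrees1980, II.1.1] -/
theorem doubleCosetOperator_mul_pow_two (hd : UnramifiedLocalConjDatum σ ϖ) (hσ : ∃ x : K, σ x ≠ x)
    (t : unitaryGroupOfForm σ ((StdForm.antidiagonal 2).over K)) (ht : (t : GL (Fin 2) K) = zpowDiagGL (uniformizer_ne_zero hd.vϖ) ![(1 : ℤ), -1])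
    {m : ℕ} (hm : 2 ≤ m) :
    doubleCosetOperator (k := k) (unitaryInt σ ((StdForm.antidiagonal 2).over K)) t *
        doubleCosetOperator (unitaryInt σ ((StdForm.antidiagonal 2).over K)) (t ^ m) =
      doubleCosetOperator (unitaryInt σ ((StdForm.antidiagonal 2).over K)) (t ^ (m + 1)) +
        ((Nat.sqrt (Nat.card 𝓀[K]) - 1 : ℕ) : k) • doubleCosetOperator (unitaryInt σ ((StdForm.antidiagonal 2).over K)) (t ^ m) +
        ((Nat.card 𝓀[K] : ℕ) : k) • doubleCosetOperator (unitaryInt σ ((StdForm.antidiagonal 2).over K)) (t ^ (m - 1)) := by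
  classical
  obtain ⟨Xp, X0, hKN, htc, hinv, hD, hXp, hX0, hX, hcp, hc0⟩ := exists_contractingTransversal_unitary_two hd hσ t ht
  have h := doubleCosetOperator_mul_pow_eq_of_contracting (k := k) hKN htc hinv hD hXp hX0 hX hm
  rw [hcp, hc0] at h
  exact h

/-- **THE SQUARE OF THE BASIC HECKE OPERATOR OF `U(1,1)`** (`m = 1`): `φ₁ · φ₁ = φ₂ + (√Q − 1) · φ₁ + (Q + √Q) · 1` — the last coefficient is the degree
`#(K₀ t K₀ ∕ K₀) = Q + √Q = q_v² + q_v` (★ `card_orbit_basic_two`). [cite: Macdonald1971, Ch. V §3] [cite: CartierCorvallis1979, §IV Thm. 4.1] [cite: BruhatTits1972, (4.4.4)] -/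
theorem doubleCosetOperator_mul_self_two (hd : UnramifiedLocalConjDatum σ ϖ) (hσ : ∃ x : K, σ x ≠ x)
    (t : unitaryGroupOfForm σ ((StdForm.antidiagonal 2).over K)) (ht : (t : GL (Fin 2) K) = zpowDiagGL (uniformizer_ne_zero hd.vϖ) ![(1 : ℤ), -1]) :
    doubleCosetOperator (k := k) (unitaryInt σ ((StdForm.antidiagonal 2).over K)) t *
        doubleCosetOperator (unitaryInt σ ((StdForm.antidiagonal 2).over K)) t =
      doubleCosetOperator (unitaryInt σ ((StdForm.antidiagonal 2).over K)) (t ^ 2) +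
        ((Nat.sqrt (Nat.card 𝓀[K]) - 1 : ℕ) : k) • doubleCosetOperator (unitaryInt σ ((StdForm.antidiagonal 2).over K)) t +
        ((Nat.card 𝓀[K] + Nat.sqrt (Nat.card 𝓀[K]) : ℕ) : k) • 1 := by
  classical
  obtain ⟨Xp, X0, hKN, htc, hinv, hD, hXp, hX0, hX, hcp, hc0⟩ := exists_contractingTransversal_unitary_two hd hσ t ht
  have h := doubleCosetOperator_mul_self_eq_of_contracting (k := k) hKN htc hinv hD hXp hX0 hX
  rw [hcp, hc0] at h
  -- `Q + (√Q − 1) + 1 = Q + √Q` (`√Q ≥ 1`: the residue field is nonempty)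
  have hs : 1 ≤ Nat.sqrt (Nat.card 𝓀[K]) := by
    haveI : Nonempty 𝓀[K] := ⟨0⟩
    exact Nat.succ_le_of_lt (Nat.sqrt_pos.2 Nat.card_pos)
  have e : Nat.card 𝓀[K] + (Nat.sqrt (Nat.card 𝓀[K]) - 1) + 1 = Nat.card 𝓀[K] + Nat.sqrt (Nat.card 𝓀[K]) := by omega
  rw [e] at h
  exact h

/-! ## §2 Satake and eigenvalue forms (`k = ℂ`): `𝒮(φ_{m+1}) = √Q·(x^{ℓ₁} + x^{ℓ₋₁})·𝒮(φ_m) − Q·𝒮(φ_{m−1})` -/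

omit [Finite 𝓀[K]]
  [IsHeckeTriple (⊤ : Submonoid (unitaryGroupOfForm σ ((StdForm.antidiagonal 2).over K))) (unitaryInt σ ((StdForm.antidiagonal 2).over K))
    (unitaryInt σ ((StdForm.antidiagonal 2).over K))] in
/-- A `t ∈ U(σ, antidiag(1,1))` with matrix `diag(ϖ, ϖ⁻¹)` IS the basic element `diag(ϖ^{1·(1 − 2i)})` of ★ `UnitaryRankOneBasicHeckeOperator` (exponent vector
`i ↦ 1 · (1 − 2i) = (1, −1)`). [cite: BruhatTits1972, (4.4.3)] -/
theorem eq_basic_two (hd : UnramifiedLocalConjDatum σ ϖ) (t : unitaryGroupOfForm σ ((StdForm.antidiagonal 2).over K))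
    (ht : (t : GL (Fin 2) K) = zpowDiagGL (uniformizer_ne_zero hd.vϖ) ![(1 : ℤ), -1]) :
    t = (⟨zpowDiagGL (uniformizer_ne_zero hd.vϖ) (fun i : Fin 2 => (1 : ℤ) * (1 - 2 * (i : ℕ))),
      zpowDiagGL_mem_unitaryGroupOfForm hd.σϖ _ (rev_linear_two 1)⟩ : unitaryGroupOfForm σ ((StdForm.antidiagonal 2).over K)) := by
  refine Subtype.ext ?_
  change (t : GL (Fin 2) K) = zpowDiagGL (uniformizer_ne_zero hd.vϖ) (fun i : Fin 2 => (1 : ℤ) * (1 - 2 * (i : ℕ)))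
  rw [ht]
  congr 1
  funext i
  fin_cases i <;> simp

/-- Linear-combination bookkeeping for an algebra hom, `f (x + a • y + b • z) = f x + a • f y + b • f z` — over light carriers so that at the Hecke algebra only
unification is needed (private twin of p09's lemma, to avoid a name clash). [folklore] -/
private theorem algHom_apply_add_smul_add_smul_two {R A B : Type*} [CommSemiring R] [Semiring A] [Semiring B] [Algebra R A] [Algebra R B]
    (f : A →ₐ[R] B) (x y z : A) (a b : R) : f (x + a • y + b • z) = f x + a • f y + b • f z := by
  simp only [map_add, map_smul]

omit [IsHeckeTriple (⊤ : Submonoid (unitaryGroupOfForm σ ((StdForm.antidiagonal 2).over K))) (unitaryInt σ ((StdForm.antidiagonal 2).over K))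
    (unitaryInt σ ((StdForm.antidiagonal 2).over K))] in
/-- `((√Q − 1 : ℕ) : ℂ) = √Q − 1` (`√Q ≥ 1` for a non-empty residue field). [folklore] -/
private theorem natCast_sqrt_card_sub_one_two :
    ((Nat.sqrt (Nat.card 𝓀[K]) - 1 : ℕ) : ℂ) = (Nat.sqrt (Nat.card 𝓀[K]) : ℂ) - 1 := by
  haveI : Nonempty 𝓀[K] := ⟨0⟩
  rw [Nat.cast_sub (Nat.succ_le_of_lt (Nat.sqrt_pos.2 Nat.card_pos)), Nat.cast_one]

/-- **MACDONALD'S RECURRENCE ON THE SATAKE SIDE, `U(1,1)`** (`m ≥ 2`): `𝒮(φ_{m+1}) = √Q·(x^{(1,−1)} + x^{(−1,1)})·𝒮(φ_m) − Q·𝒮(φ_{m−1})` in `ℂ[ℤ²]` — the Hecke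
recursion `doubleCosetOperator_mul_pow_two` through the algebra hom `𝒮` together with ★ `satakeTransform_doubleCosetOperator_basic_two`
(`𝒮(φ₁) = √Q·(x^{ℓ₁}+x^{ℓ₋₁}) + (√Q−1)`): the two roots of the recurrence are `√Q x^{ℓ₁}`, `√Q x^{ℓ₋₁}`; with `𝒮(φ₀) = 1` it generates every `𝒮(φ_m)` as an explicit
`W`-invariant Laurent polynomial on the `(q_v + 1)`-regular tree. [cite: Macdonald1971, Ch. V §3] [cite: CartierCorvallis1979, §IV (4.2), Thm. 4.1] -/
theorem satakeTransform_doubleCosetOperator_mul_pow_two_succ (hd : UnramifiedLocalConjDatum σ ϖ) (hσ : ∃ x : K, σ x ≠ x)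
    (t : unitaryGroupOfForm σ ((StdForm.antidiagonal 2).over K)) (ht : (t : GL (Fin 2) K) = zpowDiagGL (uniformizer_ne_zero hd.vϖ) ![(1 : ℤ), -1])
    {m : ℕ} (hm : 2 ≤ m) :
    hd.satakeTransform (doubleCosetOperator (unitaryInt σ ((StdForm.antidiagonal 2).over K)) (t ^ (m + 1))) =
      ((Nat.sqrt (Nat.card 𝓀[K]) : ℂ) • (AddMonoidAlgebra.single (fun i : Fin 2 => (1 : ℤ) * (1 - 2 * (i : ℕ))) (1 : ℂ) +
          AddMonoidAlgebra.single (fun i : Fin 2 => (-1 : ℤ) * (1 - 2 * (i : ℕ))) 1)) *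
        hd.satakeTransform (doubleCosetOperator (unitaryInt σ ((StdForm.antidiagonal 2).over K)) (t ^ m)) -
      ((Nat.card 𝓀[K] : ℕ) : ℂ) • hd.satakeTransform (doubleCosetOperator (unitaryInt σ ((StdForm.antidiagonal 2).over K)) (t ^ (m - 1))) := by
  have h := congrArg hd.satakeTransform (doubleCosetOperator_mul_pow_two (k := ℂ) hd hσ t ht hm)
  rw [map_mul, algHom_apply_add_smul_add_smul_two, eq_basic_two hd t ht, hd.satakeTransform_doubleCosetOperator_basic_two hσ,
    ← eq_basic_two hd t ht, natCast_sqrt_card_sub_one_two] at h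
  simp only [Algebra.smul_def] at h ⊢
  linear_combination -h

/-- **MACDONALD'S RECURRENCE FOR THE UNRAMIFIED EIGENVALUES OF `U(1,1)`** (`m ≥ 2`): for every torus parameter `β ∈ (ℂˣ)²` with `z = β₀β₁⁻¹`,
`λ_β(φ_{m+1}) = √Q(z + z⁻¹)·λ_β(φ_m) − Q·λ_β(φ_{m−1})` — the Chebyshev-type recurrence whose solution is Macdonald's spherical function on the `(q_v+1)`-regular
tree (★ `heckeEigencharacter_doubleCosetOperator_basic_two`: `λ_β(φ₁) = √Q(z + z⁻¹) + √Q − 1`). [cite: Macdonald1971, Ch. V §3] [cite: CartierCorvallis1979, §IV (4.2)–(4.4), Cor. 4.2] -/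
theorem heckeEigencharacter_doubleCosetOperator_mul_pow_two_succ (hd : UnramifiedLocalConjDatum σ ϖ) (hσ : ∃ x : K, σ x ≠ x)
    (t : unitaryGroupOfForm σ ((StdForm.antidiagonal 2).over K)) (ht : (t : GL (Fin 2) K) = zpowDiagGL (uniformizer_ne_zero hd.vϖ) ![(1 : ℤ), -1])
    (β : Fin 2 → ℂˣ) {m : ℕ} (hm : 2 ≤ m) :
    hd.heckeEigencharacter β (doubleCosetOperator (unitaryInt σ ((StdForm.antidiagonal 2).over K)) (t ^ (m + 1))) =
      (Nat.sqrt (Nat.card 𝓀[K]) : ℂ) * ((β 0 : ℂ) * (β 1 : ℂ)⁻¹ + ((β 0 : ℂ) * (β 1 : ℂ)⁻¹)⁻¹) *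
          hd.heckeEigencharacter β (doubleCosetOperator (unitaryInt σ ((StdForm.antidiagonal 2).over K)) (t ^ m)) -
        ((Nat.card 𝓀[K] : ℕ) : ℂ) * hd.heckeEigencharacter β (doubleCosetOperator (unitaryInt σ ((StdForm.antidiagonal 2).over K)) (t ^ (m - 1))) := by
  have h := congrArg (hd.heckeEigencharacter β) (doubleCosetOperator_mul_pow_two (k := ℂ) hd hσ t ht hm)
  rw [map_mul, algHom_apply_add_smul_add_smul_two, eq_basic_two hd t ht, hd.heckeEigencharacter_doubleCosetOperator_basic_two hσ β,
    ← eq_basic_two hd t ht, natCast_sqrt_card_sub_one_two, smul_eq_mul, smul_eq_mul] at h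
  linear_combination -h

end Summit.HodgeConjecture.HodgeConjecture.R90.S6

end
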